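import Summits.ResolutionOfSingularities.ResolutionOfSingularities.Theorems.MarkedTransferCampaignW46CuspStaircase
import Summits.ResolutionOfSingularities.ResolutionOfSingularities.Theorems.MarkedTransferCampaignW46MohWindowProof
import Literature.AlgebraicGeometry.Resolution.BlowupDimension
import Literature.AlgebraicGeometry.Resolution.MonomialOrderReductionUnit
import HarnessLib

/-!
# [OURS · L1 W4.6, rung (iii)] The cusp staircase — local algebra: a cusp germ reproduces one stair down at the
# chart origin and nowhere else (cell res-hironaka, LADDER-RESOLUTION rung L, D-0089; slot W4.6, seat res-L1-s46-pv-5;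
# host route MarkedTransfer, `--supports stmt-ResolutionOfSingularities-16155 --as helper`)

HONEST FRAMING. Nothing here is a statement of H. Hironaka's manuscript (2017-03-23, [Hironaka2017]) and nothing here
asserts that any statement of it holds. These are THEOREMS about the OURS definitions of
`Theorems/MarkedTransferCampaignW46CuspStaircase.lean` (`CuspShape`, `CuspAt`, `cuspIndex`), proved from the tree's
blow-up library (`Literature/AlgebraicGeometry/Resolution/`: `IsBlowup.exists_reesChart_stalk`,
`isRsopPart_chartFamily_reesChart`, `ringKrullDim_localization_chartRing_le`, `pow_not_mem_pow_of_not_mem_pow`,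
`stalkIdeal_controlledTransform_of_not_mem_support`, `IsBlowup.isIso_stalkMap_of_not_mem_support`) and this seat's window
file `…MohWindowProof.lean` (`MohWindow.chart_isRegularLocalRing_and_not_mem_sq`, `MohWindow.range_vec2`). No typed
candidate carrier of the manuscript is consumed in this file at all (pure commutative algebra and blow-up geometry); no
FACT-LIST premise; no `sorry`; axioms standard. AI review is weaker than expert review.

## What is proved (namespace `…Theorems.CampaignW46.Cusp`)

* Ring level: `isUnit_add_of_mem`, `colon_span_pow_mul_eq` (`((t^b G) : (t)^b) = (G)` in a domain),
  `cuspShape_map_of_ringEquiv` / `cuspIndex_map_of_ringEquiv` (transport along ring isomorphisms),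
  `le_of_cuspShape_of_le_pow` / `lt_of_cuspShape_of_le_pow` (a presentation `(y^b + u x^d)` of an ideal inside `𝔪^b`
  has `b ≤ d`, and `b < d` if `b ∤ d` — order additivity), `cuspIndex_spec` / `cuspIndex_le` (the index is attained /
  minimal).
* `chartOrigin_span_pair_eq` — **the origin of a chart of the point blow-up of a regular surface germ**: for `R`
  regular local of embedding dimension `2` with regular system of parameters `c`, a prime `𝔴 ⊇ 𝔪 B_j` of the chart
  ring `B_j = R[𝔪/c_j]` containing `e_i = c_i/c_j` (`i ≠ j`), and a localisation `L` of `B_j` at `𝔴`: `L` is regular of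
  embedding dimension `2` and `𝔪_L = (c_j, e_i)` (`isRsopPart_chartFamily_reesChart` makes `(c_j, e_i)` part of a
  regular system of parameters, and `dim L ≤ dim R = 2`).
* `cuspShape_transform_of_le` — **self-reproduction one stair down**: for a blow-up `π` along the reduced closed point
  `π x′` with `J_{π x′} = (y^b + u x^d)` a cusp germ, `1 ≤ b < d`: if `ord_{x′} J′ ≥ b` for the controlled transform
  `J′ = (J𝒪 : 𝓘_E^b)`, then `J′_{x′} = (ε^b + u′ t^{d−b})` is a cusp germ of exponents `(b, d − b)` in the regular
  system of parameters `(t, ε) = (x, y/x)` of `𝒪_{X′,x′}` — in the chart `t = y`, and off the origin of the chart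
  `t = x`, the transform is a unit, so `x′` IS the origin of the chart `t = x`. (Inside the window `d < 2b` this is
  absurd downstream, `d − b < b`; outside it is K4.6's stair `K_{p,n} ↦ K_{p,n−p}`.)
* `cuspIndex_transform_of_not_mem_support` — off the centre the cusp index does not change.

## References

* `Theorems/MarkedTransferCampaignW46CuspStaircase.lean` (statements), `…MohWindowProof.lean`, `…MohWindowBoundary.lean`
  (this seat); L/res-L0-k46/KILL-TEST-K4.6.md §4 (rider «CuspStringStall»; ATLAS-RUN j259568: one singular child per
  step, the x-chart origin).
* The Stacks Project, Tag 0804 (charts of a blowing up), Tag 0BIQ (`B/(c_j) ≅ (R/I)[T]`), Tag 02OS (isomorphism off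
  the centre) — locators carried by the tree files cited above. [StacksProject]
* V. Cossart, O. Piltant, J. Algebra 320 (2008), proof of Prop. 4.2 (charts of a point blow-up, weak transform).
  [CossartPiltant2008]
-/

noncomputable section

set_option linter.dupNamespace false -- mandated namespace of this single-conjunct summit

open CategoryTheory AlgebraicGeometry TopologicalSpace IsLocalRing

namespace Summit.ResolutionOfSingularities.ResolutionOfSingularities.Theorems

namespace CampaignW46

open Literature.AlgebraicGeometry.Resolution
open Literature.AlgebraicGeometry.Hironaka2017.S02Preliminaries
open Literature.AlgebraicGeometry.Hironaka2017.Datum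
open Scheme.IdealSheafData

universe u

namespace Cusp

/-! ## Ring level -/

section Ring

/-- In a local ring, a unit plus an element of the maximal ideal is a unit. [folklore] -/
theorem isUnit_add_of_mem {S : Type u} [CommRing S] [IsLocalRing S] {v m : S} (hv : IsUnit v)
    (hm : m ∈ maximalIdeal S) : IsUnit (v + m) := by
  by_contra h
  have h1 : v + m ∈ maximalIdeal S := (IsLocalRing.mem_maximalIdeal _).mpr (mem_nonunits_iff.mpr h)
  have h2 : v ∈ maximalIdeal S := by
    have := sub_mem h1 hm
    rwa [add_sub_cancel_right] at this
  exact (IsLocalRing.mem_maximalIdeal _).mp h2 hv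

/-- Colon bookkeeping in a domain: `((t^b · G) : (t)^b) = (G)` for `t ≠ 0`. [folklore] -/
theorem colon_span_pow_mul_eq {S : Type u} [CommRing S] [IsDomain S] {t : S} (ht : t ≠ 0) (G : S)
    (b : ℕ) :
    Submodule.colon (Ideal.span {t ^ b * G}) ((Ideal.span {t} ^ b : Ideal S) : Set S) = Ideal.span {G} := by
  have htb : t ^ b ≠ 0 := pow_ne_zero _ ht
  apply le_antisymm
  · intro z hz
    have h1 := Submodule.mem_colon.mp hz (t ^ b)
      (by rw [Ideal.span_singleton_pow]; exact Ideal.mem_span_singleton_self _)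
    rw [smul_eq_mul] at h1
    obtain ⟨r, hr⟩ := Ideal.mem_span_singleton'.mp h1
    have hzr : z = r * G := by
      apply mul_left_cancel₀ htb
      rw [mul_comm (t ^ b) z, ← hr]
      ring
    rw [hzr]
    exact Ideal.mul_mem_left _ r (Ideal.mem_span_singleton_self _)
  · rw [Ideal.span_singleton_le_iff_mem, Submodule.mem_colon]
    intro s hs
    rw [Ideal.span_singleton_pow, SetLike.mem_coe] at hs
    obtain ⟨r, rfl⟩ := Ideal.mem_span_singleton'.mp hs
    rw [smul_eq_mul, show G * (r * t ^ b) = r * (t ^ b * G) by ring]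
    exact Ideal.mul_mem_left _ r (Ideal.mem_span_singleton_self _)

/-- `CuspShape` is transported along ring isomorphisms. [folklore] -/
theorem cuspShape_map_of_ringEquiv {b d : ℕ} {R R' : Type u} [CommRing R] [IsLocalRing R] [CommRing R']
    [IsLocalRing R'] (e : R ≃+* R') {I : Ideal R} (h : CuspShape b d R I) :
    CuspShape b d R' (I.map (e : R →+* R')) := by
  obtain ⟨hreg, hdim, x, y, hxy, u, hu, hI⟩ := h
  haveI := hreg
  refine ⟨IsRegularLocalRing.of_ringEquiv e, ?_, e x, e y, ?_, e u, hu.map e, ?_⟩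
  · rw [← map_ringEquiv_maximalIdeal e, Ideal.spanFinrank_map_eq_of_ringEquiv, hdim]
  · rw [← map_ringEquiv_maximalIdeal e, ← hxy, Ideal.map_span, Set.image_pair]
  · rw [hI, Ideal.map_span, Set.image_singleton]
    simp only [RingHom.coe_coe, map_add, map_pow, map_mul]

/-- The cusp index is invariant under ring isomorphisms. [folklore] -/
theorem cuspIndex_map_of_ringEquiv (b : ℕ) {R R' : Type u} [CommRing R] [IsLocalRing R] [CommRing R']
    [IsLocalRing R'] (e : R ≃+* R') (I : Ideal R) :
    cuspIndex b R' (I.map (e : R →+* R')) = cuspIndex b R I := by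
  unfold cuspIndex
  congr 1
  ext d
  simp only [Set.mem_setOf_eq]
  refine and_congr_right fun _ => ⟨fun h => ?_, fun h => cuspShape_map_of_ringEquiv e h⟩
  have h2 := cuspShape_map_of_ringEquiv e.symm h
  rwa [Ideal.map_of_equiv] at h2

variable {R : Type u} [CommRing R] [IsLocalRing R]

/-- At a point where `I ⊆ 𝔪^b`, a cusp presentation `I = (y^b + u x^d)` has `b ≤ d` (the order of `u x^d` is
`d`, by order additivity in the regular local ring `R`). [folklore] -/
theorem le_of_cuspShape_of_le_pow {b d : ℕ} {I : Ideal R} (h : CuspShape b d R I)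
    (hle : I ≤ maximalIdeal R ^ b) : b ≤ d := by
  classical
  obtain ⟨hreg, hdim, x, y, hxy, u, hu, hI⟩ := h
  haveI := hreg
  by_contra hlt
  rw [not_le] at hlt
  set c : Fin 2 → R := ![x, y] with hc_def
  have hc : Ideal.span (Set.range c) = maximalIdeal R := by rw [hc_def, MohWindow.range_vec2]; exact hxy
  have hrsop : IsRsopPart (c ∘ id) := isRsopPart_comp_of_rsop hdim c hc id Function.injective_id
  have hx2 : x ∉ maximalIdeal R ^ 2 := by simpa [hc_def] using hrsop.not_mem_sq 0
  have hy : y ∈ maximalIdeal R := hxy ▸ Ideal.subset_span (by simp)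
  have hxd : x ^ d ∉ maximalIdeal R ^ (d * 1 + 1) := pow_not_mem_pow_of_not_mem_pow hx2 d
  have hmemI : y ^ b + u * x ^ d ∈ maximalIdeal R ^ b := by
    apply hle
    rw [hI]
    exact Ideal.mem_span_singleton_self _
  have hmem : y ^ b + u * x ^ d ∈ maximalIdeal R ^ (d + 1) :=
    Ideal.pow_le_pow_right (show d + 1 ≤ b by omega) hmemI
  have hyb : y ^ b ∈ maximalIdeal R ^ (d + 1) :=
    Ideal.pow_le_pow_right (by omega) (Ideal.pow_mem_pow hy b)
  have h2 : u * x ^ d ∈ maximalIdeal R ^ (d + 1) := by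
    have := sub_mem hmem hyb
    rwa [add_sub_cancel_left] at this
  have h3 : x ^ d ∈ maximalIdeal R ^ (d + 1) := (Ideal.unit_mul_mem_iff_mem _ hu).mp h2
  exact hxd (by simpa using h3)

/-- Hence at such a point a presentation with `b ∤ d` has `b < d`. [folklore] -/
theorem lt_of_cuspShape_of_le_pow {b d : ℕ} {I : Ideal R} (h : CuspShape b d R I) (hnd : ¬ b ∣ d)
    (hle : I ≤ maximalIdeal R ^ b) : b < d := by
  have h1 := le_of_cuspShape_of_le_pow h hle
  rcases h1.eq_or_lt with rfl | hlt
  · exact absurd (dvd_refl _) hnd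
  · exact hlt

/-- The cusp index of a cusp germ is attained. [folklore] -/
theorem cuspIndex_spec {b : ℕ} {I : Ideal R} (h : CuspAt b R I) :
    ¬ b ∣ cuspIndex b R I ∧ CuspShape b (cuspIndex b R I) R I := by
  have hne : {d : ℕ | ¬ b ∣ d ∧ CuspShape b d R I}.Nonempty := h
  exact Nat.sInf_mem hne

/-- The cusp index is at most any admissible exponent. [folklore] -/
theorem cuspIndex_le {b d : ℕ} {I : Ideal R} (hnd : ¬ b ∣ d) (h : CuspShape b d R I) :
    cuspIndex b R I ≤ d :=
  Nat.sInf_le ⟨hnd, h⟩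

end Ring

/-! ## The origin of a chart of the point blow-up of a regular surface germ -/

section Origin

variable {R : Type u} [CommRing R] [IsRegularLocalRing R]

/-- **At the origin of the chart `D₊(c_j t)` the pair `(c_j, c_i/c_j)` is a regular system of parameters.** For a
regular local ring `R` of embedding dimension `2` with regular system of parameters `c = (c₀, c₁)`, a prime `𝔴` of
the chart ring `B_j = R[𝔪/c_j]` over `𝔪_R` containing the chart generator `e_i = c_i/c_j` (`i ≠ j`), and a
localisation `L` of `B_j` at `𝔴`: `𝔪_L = (c_j, e_i)` and `L` is regular of embedding dimension `2` (part of a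
regular system of parameters by the tree's `isRsopPart_chartFamily_reesChart`, all of it because
`dim L ≤ dim R = 2`, `ringKrullDim_localization_chartRing_le`). [cite: StacksProject, Tag 0BIQ] -/
theorem chartOrigin_span_pair_eq (hd : (maximalIdeal R).spanFinrank = 2)
    (c : Fin 2 → R) (hc : Ideal.span (Set.range c) = maximalIdeal R) {i j : Fin 2} (hij : i ≠ j)
    (𝔴 : Ideal (chartRing c j)) [𝔴.IsPrime] (h𝔴 : 𝔴.comap (chartBase c j) = maximalIdeal R)
    (hi : chartGen c j i ∈ 𝔴)
    (L : Type u) [CommRing L] [IsLocalRing L] [Algebra (chartRing c j) L] [IsLocalization.AtPrime L 𝔴] :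
    IsRegularLocalRing L ∧ (maximalIdeal L).spanFinrank = 2 ∧
      Ideal.span {(algebraMap (chartRing c j) L : chartRing c j →+* L) (chartBase c j (c j)),
        (algebraMap (chartRing c j) L : chartRing c j →+* L) (chartGen c j i)} = maximalIdeal L := by
  classical
  have hz : Ideal.span (Set.range (Fin.append c (fun k : Fin 0 => Fin.elim0 k))) = maximalIdeal R := by
    rw [← hc]
    congr 1
    ext r
    constructor
    · rintro ⟨k, rfl⟩
      refine Fin.addCases (fun k => ⟨k, ?_⟩) (fun k => Fin.elim0 k) k
      rw [Fin.append_left]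
    · rintro ⟨k, rfl⟩
      exact ⟨Fin.castAdd 0 k, by rw [Fin.append_left]⟩
  set jJ : Fin 1 → {k : Fin 2 // k ≠ j} := fun _ => ⟨i, hij⟩ with hjJ_def
  have hjJ : Function.Injective jJ := Function.injective_of_subsingleton _
  have hrsop := isRsopPart_chartFamily_reesChart c j (fun k : Fin 0 => Fin.elim0 k) hz
    (by rw [hd]) 𝔴 h𝔴 L jJ hjJ (fun _ => hi)
  obtain ⟨hLreg, e, yv, hdimL, hspan⟩ := hrsop
  haveI := hLreg
  -- `dim L ≤ dim R = 2`, so `e = 0`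
  haveI := isDomain_of_isRegularLocalRing R
  have hdimR : ringKrullDim R = (2 : ℕ) := by
    rw [← IsRegularLocalRing.spanFinrank_maximalIdeal, hd]
  have hle : ringKrullDim L ≤ ringKrullDim R := ringKrullDim_localization_chartRing_le c j 𝔴 h𝔴 L
  rw [hdimL, hdimR] at hle
  have he : e = 0 := by
    have : (1 + 0 + 1 + e : ℕ) ≤ 2 := by exact_mod_cast hle
    omega
  subst he
  have hspan' : Ideal.span (Set.range (chartFamily c j (fun k : Fin 0 => Fin.elim0 k) L (chartBase c j)
      (chartGen c j) jJ)) = maximalIdeal L := by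
    rw [← hspan, Set.range_eq_empty yv, Set.union_empty]
  refine ⟨hLreg, ?_, ?_⟩
  · have h := IsRegularLocalRing.spanFinrank_maximalIdeal (R := L)
    rw [hdimL] at h
    exact_mod_cast h
  · apply le_antisymm
    · rw [Ideal.span_le]
      intro z hz
      rcases hz with rfl | rfl
      · exact (IsLocalization.AtPrime.to_map_mem_maximal_iff _ 𝔴 _).mpr
          (by rw [← Ideal.mem_comap, h𝔴, ← hc]; exact Ideal.subset_span ⟨j, rfl⟩)
      · exact (IsLocalization.AtPrime.to_map_mem_maximal_iff _ 𝔴 _).mpr hi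
    · rw [← hspan', Ideal.span_le]
      rintro _ ⟨k, rfl⟩
      refine Fin.cases ?_ (fun k' => ?_) k
      · simp only [chartFamily, Fin.cons_zero]
        exact Ideal.subset_span (Or.inl rfl)
      · simp only [chartFamily, Fin.cons_succ]
        have hk : k' = Fin.castAdd 0 (0 : Fin 1) := Subsingleton.elim _ _
        rw [hk, Fin.append_left]
        exact Ideal.subset_span (Or.inr rfl)

end Origin

/-! ## Scheme level: the transform of a cusp germ under the point blow-up -/

section Local

variable {X X' : Scheme.{u}} {π : X' ⟶ X}

/-- **Self-reproduction of cusp germs under the point blow-up (all exponents).** Let `π : X′ → X` be a blow-up along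
the ideal of a closed `Y` with `𝓘_{Y,π x′} = 𝔪_{π x′}`, and let `J_{π x′} = (y^b + u·x^d)` be a cusp germ
(`CuspShape b d`) with `1 ≤ b < d`. If `x′` is singular for the transform, `ord_{x′} J′ ≥ b` with
`J′ = (J𝒪_{X′} : 𝓘_E^b)`, then `x′` is the origin of the chart `t = x` and `J′_{x′} = (ε^b + u′·t^{d−b})` is again a
cusp germ, of exponents `(b, d − b)`, in the regular system of parameters `(t, ε) = (x, y/x)` of `𝒪_{X′,x′}` (in the
chart `t = y`, and off the origin of the chart `t = x`, the transform is a unit). For `d < 2b` this contradicts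
`ord ≥ b` downstream (`d − b < b`, `le_of_cuspShape_of_le_pow`): the window case of `MohWindowCurveStepDrop`.
[cite: StacksProject, Tag 0804] -/
theorem cuspShape_transform_of_le [IsLocallyNoetherian X'] {Y : Closeds X}
    (hπ : IsBlowup π (vanishingIdeal Y)) {J : X.IdealSheafData} {b d : ℕ} (hb : 1 ≤ b) (hbd : b < d)
    {x' : X'} (hY : stalkIdeal (vanishingIdeal Y) (π x') = maximalIdeal (X.presheaf.stalk (π x')))
    (hW : CuspShape b d (X.presheaf.stalk (π x')) (stalkIdeal J (π x')))
    (hle : (b : ℕ∞) ≤ idealOrder (controlledTransform π (vanishingIdeal Y) J b) x') :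
    CuspShape b (d - b) (X'.presheaf.stalk x')
      (stalkIdeal (controlledTransform π (vanishingIdeal Y) J b) x') := by
  classical
  obtain ⟨hreg, hdim, x, y, hxy, u, hu, hJ⟩ := hW
  haveI := hreg
  obtain ⟨m, rfl⟩ : ∃ m, d = b + m := Nat.exists_eq_add_of_le hbd.le
  have hm1 : 1 ≤ m := by omega
  obtain ⟨c, hc_def⟩ : ∃ c : Fin 2 → X.presheaf.stalk (π x'), c = ![x, y] := ⟨_, rfl⟩
  have hc0 : c 0 = x := by rw [hc_def]; rfl
  have hc1 : c 1 = y := by rw [hc_def]; rfl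
  have hc : Ideal.span (Set.range c) = maximalIdeal _ := by rw [hc_def, MohWindow.range_vec2]; exact hxy
  have hcY : Ideal.span (Set.range c) = stalkIdeal (vanishingIdeal Y) (π x') := hc.trans hY.symm
  have hJc : stalkIdeal J (π x') = Ideal.span {c 1 ^ b + u * c 0 ^ (b + m)} := by rw [hJ, hc0, hc1]
  obtain ⟨j, 𝔴, χ, hχ, hloc, h𝔴⟩ := hπ.exists_reesChart_stalk x' c hcY
  letI := χ.toAlgebra
  haveI : IsLocalization.AtPrime (X'.presheaf.stalk x') 𝔴.asIdeal := hloc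
  have halg : ∀ w, (algebraMap (chartRing c j) (X'.presheaf.stalk x') :
      chartRing c j →+* X'.presheaf.stalk x') w = χ w := fun _ => rfl
  obtain ⟨hLreg, ht1, ht2⟩ :=
    MohWindow.chart_isRegularLocalRing_and_not_mem_sq hdim c hc j 𝔴.asIdeal h𝔴 (X'.presheaf.stalk x')
  haveI := hLreg
  haveI := isDomain_of_isRegularLocalRing (X'.presheaf.stalk x')
  -- `ψ = π^♯_{x′}` (introduced by hand: `set` would try to abstract it inside the chart data)
  obtain ⟨ψ, hψ⟩ : ∃ ψ : X.presheaf.stalk (π x') →+* X'.presheaf.stalk x', ψ = (π.stalkMap x').hom :=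
    ⟨_, rfl⟩
  have hχψ : ∀ a, χ (chartBase c j a) = ψ a := fun a => by rw [hψ]; exact hχ a
  rw [halg, hχψ] at ht1 ht2
  have hrel : ∀ i, ψ (c i) = ψ (c j) * χ (chartGen c j i) := by
    rw [hψ]; exact stalkMap_apply_eq_mul_chartGen j χ hχ
  have ht0 : ψ (c j) ≠ 0 := fun h => ht2 (by rw [h]; exact zero_mem _)
  have hv : IsUnit (ψ u) := hu.map ψ
  -- `J′_{x′} = ((ψ g) : (ψ c_j)^b) = (G)` whenever `ψ g = (ψ c_j)^b · G`
  have hcYmap : (stalkIdeal (vanishingIdeal Y) (π x')).map ψ = Ideal.span {ψ (c j)} := by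
    rw [← hcY, Ideal.map_span_range_eq_span_singleton _ c j _ hrel]
  have hJ' : ∀ G : X'.presheaf.stalk x', ψ (c 1 ^ b + u * c 0 ^ (b + m)) = ψ (c j) ^ b * G →
      stalkIdeal (controlledTransform π (vanishingIdeal Y) J b) x' = Ideal.span {G} := by
    intro G hG
    have hJmap : (stalkIdeal J (π x')).map ψ = Ideal.span {ψ (c j) ^ b * G} := by
      rw [hJc, Ideal.map_span, Set.image_singleton, hG]
    rw [controlledTransform, stalkIdeal_colon, stalkIdeal_pow, stalkIdeal_comap_eq_map_stalkMap,
      stalkIdeal_comap_eq_map_stalkMap, ← hψ, hcYmap, hJmap]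
    exact colon_span_pow_mul_eq ht0 G b
  -- `J′_{x′} ⊆ 𝔪^b`, so such a `G` is never a unit
  have hJ'le : stalkIdeal (controlledTransform π (vanishingIdeal Y) J b) x' ≤
      maximalIdeal (X'.presheaf.stalk x') ^ b := (le_idealOrder_iff _ x' b).mp hle
  have hnotunit : ∀ G : X'.presheaf.stalk x', ψ (c 1 ^ b + u * c 0 ^ (b + m)) = ψ (c j) ^ b * G →
      ¬ IsUnit G := by
    intro G hG hGu
    have h1 : stalkIdeal (controlledTransform π (vanishingIdeal Y) J b) x' = ⊤ := by
      rw [hJ' G hG]; exact Ideal.span_singleton_eq_top.mpr hGu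
    have h2 : (⊤ : Ideal (X'.presheaf.stalk x')) ≤ maximalIdeal _ ^ b := h1 ▸ hJ'le
    have h3 : (1 : X'.presheaf.stalk x') ∈ maximalIdeal _ :=
      Ideal.pow_le_self (by omega) (h2 Submodule.mem_top)
    exact (maximalIdeal.isMaximal _).ne_top ((Ideal.eq_top_iff_one _).mpr h3)
  have hL : ψ (c 1 ^ b + u * c 0 ^ (b + m)) = ψ (c 1) ^ b + ψ u * ψ (c 0) ^ (b + m) := by
    simp only [map_add, map_mul, map_pow]
  obtain rfl | rfl : j = 0 ∨ j = 1 := Fin.exists_fin_two.mp ⟨j, rfl⟩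
  · -- chart `t = x`: `G = ε^b + ψu · t^m`, `ε = χ e₁`
    have hG : ψ (c 1 ^ b + u * c 0 ^ (b + m)) =
        ψ (c 0) ^ b * (χ (chartGen c 0 1) ^ b + ψ u * ψ (c 0) ^ m) := by
      rewrite [hL, hrel 1]
      ring
    -- `ε ∈ 𝔪_{x′}` (else `G` is a unit), i.e. `x′` is the origin of the chart
    have hε : χ (chartGen c 0 1) ∈ maximalIdeal (X'.presheaf.stalk x') := by
      by_contra hεm
      have hεu : IsUnit (χ (chartGen c 0 1)) := by
        by_contra h
        exact hεm ((IsLocalRing.mem_maximalIdeal _).mpr (mem_nonunits_iff.mpr h))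
      exact hnotunit _ hG
        (isUnit_add_of_mem (hεu.pow b) (Ideal.mul_mem_left _ _ (Ideal.pow_mem_of_mem _ ht1 m hm1)))
    have hw : chartGen c 0 1 ∈ 𝔴.asIdeal := by
      rw [← halg] at hε
      exact (IsLocalization.AtPrime.to_map_mem_maximal_iff _ 𝔴.asIdeal _).mp hε
    obtain ⟨-, hdimL, hspanL⟩ := chartOrigin_span_pair_eq hdim c hc (i := 1) (j := 0) (by decide)
      𝔴.asIdeal h𝔴 hw (X'.presheaf.stalk x')
    rw [halg, halg, hχψ] at hspanL
    refine ⟨hLreg, hdimL, ψ (c 0), χ (chartGen c 0 1), hspanL, ψ u, hv, ?_⟩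
    rw [hJ' _ hG, show b + m - b = m from by omega]
  · -- chart `t = y`: `G = 1 + ψu · t^m · ε^{b+m}` is a unit — impossible at a singular point
    exfalso
    have hG : ψ (c 1 ^ b + u * c 0 ^ (b + m)) =
        ψ (c 1) ^ b * (1 + ψ u * (ψ (c 1) ^ m * χ (chartGen c 1 0) ^ (b + m))) := by
      rewrite [hL, hrel 0]
      ring
    exact hnotunit _ hG (isUnit_add_of_mem isUnit_one
      (Ideal.mul_mem_left _ _ (Ideal.mul_mem_right _ _ (Ideal.pow_mem_of_mem _ ht1 m hm1))))

/-- **Off the centre nothing changes**: for `π x′ ∉ V(C)` the cusp index of the transform at `x′` equals the cusp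
index at `π x′` (`π` is a local isomorphism there and `J′_{x′} = J_{π x′}𝒪_{X′,x′}`). [cite: StacksProject, Tag 02OS] -/
theorem cuspIndex_transform_of_not_mem_support [IsLocallyNoetherian X'] {C : X.IdealSheafData}
    (hπ : IsBlowup π C) (J : X.IdealSheafData) (b : ℕ) {x' : X'} (hxC : π x' ∉ C.support) :
    cuspIndex b (X'.presheaf.stalk x') (stalkIdeal (controlledTransform π C J b) x') =
      cuspIndex b (X.presheaf.stalk (π x')) (stalkIdeal J (π x')) := by
  haveI := hπ.isIso_stalkMap_of_not_mem_support hxC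
  let ε : X.presheaf.stalk (π x') ≃+* X'.presheaf.stalk x' :=
    (asIso (π.stalkMap x')).commRingCatIsoToRingEquiv
  have hε : (ε : X.presheaf.stalk (π x') →+* X'.presheaf.stalk x') = (π.stalkMap x').hom := rfl
  rw [stalkIdeal_controlledTransform_of_not_mem_support J b hxC, ← hε, cuspIndex_map_of_ringEquiv]

end Local

end Cusp

end CampaignW46

end Summit.ResolutionOfSingularities.ResolutionOfSingularities.Theorems

end
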